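import Literature.Barriers.SmoothPoincare4.ExoticOpenFourSpaceSchoenfliesProofs
import Literature.Topology.Euclidean.InvarianceOfDomain
import HarnessLib

/-!
# `deMichelisFreedman1992_continuum`: Thm. 3.2, last steps — a topological product structure near
# the end extends, by the Schoenflies theorem, to a global radial coordinate; normalisation

Proof file in the cone of the named fact
`Literature.Barriers.SmoothPoincare4.deMichelisFreedman1992_continuum` (DeMichelis–Freedman 1992,
Thm. 4.1 with Cor. 4.1: continuum many pairwise non-diffeomorphic open subsets of standard `ℝ⁴`,
each homeomorphic to `ℝ⁴`; `ExoticOpenFourSpace.lean`), sibling of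
`ExoticOpenFourSpaceSchoenfliesProofs` (the last assertion of Thm. 4.1: a radial function restricted
to `[0, r]` extends to a polar coordinate on all of `ℝ⁴`), whose tools it reuses, and of
`ExoticOpenFourSpacePolarProofs` (the polar family `polarBall R e t` of Thms. 3.2/4.1).

Thm. 3.2 (p. 244, verbatim): "If `R⁴` is a ribbon 4-space and `K ⊂ R⁴` is a compactum, then there
exists a topological radius function (polar coordinate) `ρ : R⁴ → [0, +∞)` such that if we set
`t = 1 − 1/r` and `R⁴_t = ρ⁻¹([0, r))` then `K ⊂ R⁴₀` and `R⁴_t` is also a ribbon 4-space for `t`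
belonging to the standard Cantor set `CS ⊂ [0, 1]`." Its proof (pp. 244–246) coordinatises the
design of the generalized Casson handles by decomposition theory ([11], [12]) — not formalizable
with present vocabulary — and then ends (pp. 245–246, verbatim):

> "Since `R⁴₁` arises from a smooth handle body `H` by attaching GCH's with radius `ρ = 1` (and
> then deleting the remaining boundary) and since `ρ` is perfectly standard in a neighborhood of
> the attaching region, it is a simple matter to find a topological product structure near
> end(`R⁴₁`) whose levels are `ρ` levels on the GCH and agree with a previously specified product
> structure near `∂H` away from a neighborhood of the `⋃ GCH` (see Figure 3.12). **The Schoenflies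
> theorem allows this product structure near infinity to be extended to a global radial
> coordinate. The further conditions of Theorem 3.2 are now just a question of normalization,
> q.e.d.**"

THIS FILE PROVES the two closing sentences, for every `n ≥ 2`:

* `exists_homeomorph_eq_of_endCollar` (**Schoenflies step, in `ℝⁿ`**): if `φ` is a closed collar of
  the end of `ℝⁿ` — continuous and injective on an exterior region `{‖y‖ ≥ a}`, running out to the
  end (`φ(y) → ∞` as `y → ∞`), with `ℝⁿ ∖ φ({‖y‖ ≥ a})` bounded (a "topological product structure
  near infinity", its levels the spheres `φ(∂B(0, s))`) — then for every `b > a`, `b > 0`, some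
  homeomorphism `G` of `ℝⁿ` agrees with `φ` on `{‖y‖ ≥ b}`;
* `exists_homeomorph_eq_of_endCollar_of_homeomorph`, `…_four` (**the same for a space `R ≅ ℝⁿ`**,
  the case of the paper: `R⁴₁` is a ribbon `ℝ⁴`, homeomorphic to `ℝ⁴` by Thm. 3.1 (3)): a closed
  collar `φ` of the end of `R` (now `φ → ∞` means `φ` tends to the cocompact filter of `R`, and the
  complement of the image is relatively compact) agrees on `{‖y‖ ≥ b}` with a homeomorphism
  `G : ℝⁿ ≅ R`, so that (`exists_homeomorph_norm_symm_eq_of_endCollar`) the topological radial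
  function `ρ = ‖G⁻¹ ·‖` ("a homeomorphism followed by the usual radius function", p. 246) has
  `ρ(φ y) = ‖y‖` for `‖y‖ ≥ b`, levels `{ρ = s} = φ(∂B(0, s))` and exterior regions
  `{ρ ≥ s} = φ({‖y‖ ≥ s})` for `s ≥ b` — **the product structure near infinity extended to a global
  radial coordinate**;
* `exists_polar_normalisation` (**normalisation step**, for the tree's polar family
  `polarBall R e t = {(1 − t) ρ < 1}`, `ρ = ‖e ·‖`, `r = (1 − t)⁻¹`): if a property `P` of the polar
  balls holds for the Cantor parameters of a final segment `t ≥ t₀` (`t₀ < 1`) and `K ⊆ R` is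
  compact, then rescaling the radial function by `3⁻ᵐ`, `m` large (`polarBall_trans_smul`: this
  reparametrises the family along the self-similarity `t ↦ 1 − (1 − t)/3ᵐ` of `CS`,
  `one_sub_div_pow_mem_cantorSet`), gives polar coordinates `e'` with `K ⊆ R'_0` and `P(R'_t)` for
  EVERY `t ∈ CS` — the "further conditions of Theorem 3.2".

Proof of the Schoenflies step, as printed, by M. Brown's generalized Schoenflies theorem (PROVED in
the tree: `Literature/Topology/FourManifolds/Schoenflies{Cellularity,Brown,Flat,Separation}.lean`,
used through the round-ball cell form `IsTopSphere.nonempty_homeomorph_compl_image_ball` of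
`FreedmanApproximation.lean` §1) and Brouwer's invariance of domain (PROVED in the tree,
`Literature/Topology/Euclidean/InvarianceOfDomain.lean`): in `S = ℝⁿ ∪ {∞} ≅ Sⁿ` (Mathlib's
`onePointEquivSphereOfFinrankEq`) the level `φ(∂B(0, b))` is a bicollared `(n−1)`-sphere, so the
closure `ℝⁿ ∖ φ({‖y‖ > b})` of its bounded side is an `n`-cell. Concretely: Step 1, two tame closed
balls `k, k₀ : B̄(0, 2) → S` in a topological `n`-sphere are matched by a homeomorphism `F` of `S`,
`F ∘ k = k₀` on `B̄(0, 1)` (Schoenflies for both, a cone over the boundary correspondence —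
Alexander trick, the tree's `coneHomeomorph` — and pasting along the closed cover); Step 2, a radial
reparametrisation `σ(x) = (γ(‖x‖)/‖x‖) x` of `ℝⁿ ∖ {0}` (`γ(s) = max (b/s) (b − (b − c)(s − 1))`)
carrying the punctured ball `B̄(0, 2) ∖ {0}` injectively into `{‖y‖ > a}`, the unit sphere onto
`∂B(0, b)`, and `x → 0` to `∞`; Step 3, the collar with `∞` filled in, `k = Θ ∘ φ ∘ σ`, `k(0) = ∞`,
and the standard exterior `k₀` (`φ = id`) are tame balls: continuous at `0` because the collar runs
out to the end, injective, and with open images of balls — by invariance of domain on `ℝⁿ`, plus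
compactness of `ℝⁿ ∖ φ(σ(B(0, r) ∖ {0}))` (closed, and bounded via the explicit inverse of `σ`);
Step 4, `F` fixes `∞ = k(0) = k₀(0)`, descends (`exists_homeomorph_conj_of_apply_eq`) to
`H : ℝⁿ ≅ ℝⁿ` with `H ∘ φ = id` on `{‖y‖ ≥ b}`, and `G = H⁻¹`. Step 5 is the normalisation.

No named fact is introduced (D-0026): `endProfile`, `endRadialMap`, `collarSphereMap` are explicit
definitions with bodies, everything else is a theorem.

## References

* S. DeMichelis, M. H. Freedman, *Uncountably many exotic `R⁴`'s in standard 4-space*,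
  J. Differential Geom. 35 (1992) 219–254: Thm. 3.2 (p. 244) and the end of its proof
  (pp. 245–246); Thm. 3.1 (3) (p. 234); §4, p. 246 (topological radial functions)
  [DeMichelisFreedman1992].
* M. Brown, *A proof of the generalized Schoenflies theorem*, Bull. Amer. Math. Soc. 66 (1960)
  74–76; R. J. Daverman, *Decompositions of manifolds* (1986), §II.6 Thm. 6 — as vendored and
  proved in `Literature/Topology/FourManifolds/SchoenfliesSeparation.lean` [Daverman1986].
* T. Tao, *Hilbert's fifth problem and related topics* (2014), Thm. 6.0.12 (invariance of domain) —
  as proved in `Literature/Topology/Euclidean/InvarianceOfDomain.lean` [Tao2014].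

[DeMichelisFreedman1992]
-/

noncomputable section

open Set Function Metric Filter Topology Bornology
open Literature.Topology.FourManifolds

namespace Literature.Barriers.SmoothPoincare4

/-- Local notation: `𝔼 n` is the model Euclidean space `EuclideanSpace ℝ (Fin n)`. -/
local notation "𝔼 " n:arg => EuclideanSpace ℝ (Fin n)

variable {n : ℕ}

/-! ### Step 1. Two tame closed balls in a topological sphere are ambiently equivalent -/

/-- **The boundary correspondence as a homeomorphism of spheres** (local form of
`exists_sphere_homeomorph_boundary`: `k` need only be continuous and injective on the closed ball).
For `k` continuous and injective on `B̄(0, r)` (`S` Hausdorff) and a homeomorphism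
`Ψ : S ∖ k(B(0, r)) ≅ B̄ⁿ` whose norm-one set is exactly `k(∂B(0, r))`, the map `w ↦ Ψ(k w)` is a
homeomorphism `∂B(0, r) ≅ ∂B̄ⁿ`. [folklore] -/
theorem exists_sphere_homeomorph_boundary_of_continuousOn {S : Type*} [TopologicalSpace S]
    [T2Space S] {k : 𝔼 n → S} {r : ℝ} (hkc : ContinuousOn k (closedBall 0 r))
    (hki : InjOn k (closedBall 0 r))
    (Ψ : ↥(k '' ball (0 : 𝔼 n) r)ᶜ ≃ₜ closedBall (0 : 𝔼 n) 1)
    (hb : ∀ z, ‖(Ψ z : 𝔼 n)‖ = 1 ↔ (z : S) ∈ k '' sphere (0 : 𝔼 n) r) :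
    ∃ β : sphere (0 : 𝔼 n) r ≃ₜ sphere (0 : 𝔼 n) 1,
      ∀ (w : 𝔼 n) (hw : w ∈ sphere (0 : 𝔼 n) r) (hm : k w ∈ (k '' ball (0 : 𝔼 n) r)ᶜ),
        (β ⟨w, hw⟩ : 𝔼 n) = Ψ ⟨k w, hm⟩ := by
  have hmem : ∀ w : sphere (0 : 𝔼 n) r, k w ∈ (k '' ball (0 : 𝔼 n) r)ᶜ := by
    rintro ⟨w, hw⟩ ⟨v, hv, hvw⟩
    have h := hki (ball_subset_closedBall hv) (sphere_subset_closedBall hw) hvw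
    rw [h, mem_ball_zero_iff, mem_sphere_zero_iff_norm.1 hw] at hv
    exact lt_irrefl _ hv
  have hone : ∀ w : sphere (0 : 𝔼 n) r, ‖(Ψ ⟨k w, hmem w⟩ : 𝔼 n)‖ = 1 := fun w ↦
    (hb _).2 ⟨w, w.2, rfl⟩
  set βf : sphere (0 : 𝔼 n) r → sphere (0 : 𝔼 n) 1 :=
    fun w ↦ ⟨Ψ ⟨k w, hmem w⟩, mem_sphere_zero_iff_norm.2 (hone w)⟩ with hβf
  have hcont : Continuous βf := by
    refine Continuous.subtype_mk (continuous_subtype_val.comp (Ψ.continuous.comp ?_)) _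
    refine Continuous.subtype_mk ?_ _
    exact (hkc.mono sphere_subset_closedBall).comp_continuous continuous_subtype_val
      fun w ↦ w.2
  have hinj : Injective βf := by
    intro w₁ w₂ h
    simp only [hβf, Subtype.mk.injEq] at h
    have h2 := congrArg Subtype.val (Ψ.injective (Subtype.ext h))
    exact Subtype.ext (hki (sphere_subset_closedBall w₁.2) (sphere_subset_closedBall w₂.2) h2)
  have hsurj : Surjective βf := by
    intro u
    set z := Ψ.symm ⟨u, sphere_subset_closedBall u.2⟩ with hz
    have hz1 : ‖(Ψ z : 𝔼 n)‖ = 1 := by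
      rw [hz, Homeomorph.apply_symm_apply]
      exact mem_sphere_zero_iff_norm.1 u.2
    obtain ⟨w, hw, hkw⟩ := (hb z).1 hz1
    refine ⟨⟨w, hw⟩, Subtype.ext ?_⟩
    have h3 : (⟨k w, hmem ⟨w, hw⟩⟩ : ↥(k '' ball (0 : 𝔼 n) r)ᶜ) = z := Subtype.ext hkw
    show (Ψ ⟨k w, hmem ⟨w, hw⟩⟩ : 𝔼 n) = u
    rw [h3, hz, Homeomorph.apply_symm_apply]
  exact ⟨Continuous.homeoOfEquivCompactToT2 (f := Equiv.ofBijective βf ⟨hinj, hsurj⟩) hcont,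
    fun w hw hm ↦ rfl⟩

/-- **Two tame closed balls in a topological sphere are ambiently equivalent, matching their
parametrisations** (`n ≥ 2`). Let `S` be a compact metric topological `n`-sphere and
`k, k₀ : ℝⁿ → S` continuous and injective on `B̄(0, 2)` with `k(B(0, r))`, `k₀(B(0, r))` open for
`0 < r ≤ 2`. Then some homeomorphism `F` of `S` satisfies `F (k w) = k₀ w` for all `‖w‖ ≤ 1`.
Proof: by the generalized Schoenflies theorem (Brown 1960; the tree's
`IsTopSphere.nonempty_homeomorph_compl_image_ball`, boundary identified by
`IsTopSphere.norm_eq_one_iff_compl_image_ball`) both `S ∖ k(B(0, 1))` and `S ∖ k₀(B(0, 1))` are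
`n`-cells with boundary spheres `k(∂B(0, 1))`, `k₀(∂B(0, 1))`; coning the boundary correspondence
(Alexander trick, `coneHomeomorph`) gives a homeomorphism `Ω` of the two cells with
`Ω (k w) = k₀ w` for `‖w‖ = 1`, which pastes with `k₀ ∘ k⁻¹` on `k(B̄(0, 1))` to a continuous
bijection of the compact Hausdorff space `S`. [cite: Daverman1986, §II.6 Thm. 6 and the remark
before Prop. 3] -/
theorem exists_homeomorph_sphere_two_balls {S : Type*} [MetricSpace S] [CompactSpace S]
    (hS : IsTopSphere n S) (hn : 2 ≤ n) {k k₀ : 𝔼 n → S}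
    (hkc : ContinuousOn k (closedBall 0 2)) (hki : InjOn k (closedBall 0 2))
    (hko : ∀ r, 0 < r → r ≤ 2 → IsOpen (k '' ball 0 r))
    (hk₀c : ContinuousOn k₀ (closedBall 0 2)) (hk₀i : InjOn k₀ (closedBall 0 2))
    (hk₀o : ∀ r, 0 < r → r ≤ 2 → IsOpen (k₀ '' ball 0 r)) :
    ∃ F : S ≃ₜ S, ∀ w ∈ closedBall (0 : 𝔼 n) 1, F (k w) = k₀ w := by
  classical
  -- the two cells (generalized Schoenflies theorem) and their boundary spheres
  have cell : ∀ {g : 𝔼 n → S}, ContinuousOn g (closedBall 0 2) → InjOn g (closedBall 0 2) →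
      (∀ r, 0 < r → r ≤ 2 → IsOpen (g '' ball 0 r)) →
      ∃ Ψ : ↥(g '' ball (0 : 𝔼 n) 1)ᶜ ≃ₜ closedBall (0 : 𝔼 n) 1,
        ∀ z, ‖(Ψ z : 𝔼 n)‖ = 1 ↔ (z : S) ∈ g '' sphere (0 : 𝔼 n) 1 := by
    intro g hgc hgi hgo
    have hgc' : ContinuousOn g (closedBall (0 : 𝔼 n) (2 * 1)) := by rwa [mul_one]
    have hgi' : InjOn g (closedBall (0 : 𝔼 n) (2 * 1)) := by rwa [mul_one]
    have hgo' : ∀ r, 0 < r → r ≤ 2 * 1 → IsOpen (g '' ball (0 : 𝔼 n) r) := by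
      rw [mul_one]; exact hgo
    obtain ⟨Ψ⟩ := hS.nonempty_homeomorph_compl_image_ball hn one_pos hgc' hgi' hgo'
    exact ⟨Ψ, fun z ↦ hS.norm_eq_one_iff_compl_image_ball one_pos hgc' Ψ z⟩
  obtain ⟨Ψ, hb⟩ := cell hkc hki hko
  obtain ⟨Ψ₀, hb₀⟩ := cell hk₀c hk₀i hk₀o
  have h12 : closedBall (0 : 𝔼 n) 1 ⊆ closedBall 0 2 := closedBall_subset_closedBall one_le_two
  obtain ⟨β, hβ⟩ := exists_sphere_homeomorph_boundary_of_continuousOn (hkc.mono h12)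
    (hki.mono h12) Ψ hb
  obtain ⟨β₀, hβ₀⟩ := exists_sphere_homeomorph_boundary_of_continuousOn (hk₀c.mono h12)
    (hk₀i.mono h12) Ψ₀ hb₀
  -- the cone over the boundary correspondence and the homeomorphism `Ω` of the cells
  set φ : sphere (0 : 𝔼 n) 1 ≃ₜ sphere (0 : 𝔼 n) 1 := β.symm.trans β₀ with hφ
  haveI : Nonempty (sphere (0 : 𝔼 n) 1) :=
    ⟨⟨EuclideanSpace.single (⟨0, by omega⟩ : Fin n) (1 : ℝ), by simp⟩⟩
  set Φ := coneHomeomorph φ with hΦ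
  set Ω : ↥(k '' ball (0 : 𝔼 n) 1)ᶜ ≃ₜ ↥(k₀ '' ball (0 : 𝔼 n) 1)ᶜ :=
    Ψ.trans (Φ.trans Ψ₀.symm) with hΩ
  have hΩk : ∀ w ∈ sphere (0 : 𝔼 n) 1, ∀ hm hm₀, Ω ⟨k w, hm⟩ = ⟨k₀ w, hm₀⟩ := by
    intro w hw hm hm₀
    rw [hΩ, Homeomorph.trans_apply, Homeomorph.trans_apply, Homeomorph.symm_apply_eq]
    apply Subtype.ext
    have h1 : ‖(Ψ ⟨k w, hm⟩ : 𝔼 n)‖ = 1 := (hb _).2 ⟨w, hw, rfl⟩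
    rw [hΦ, coneHomeomorph_apply_of_norm_eq_one φ _ h1]
    have h2 : (⟨(Ψ ⟨k w, hm⟩ : 𝔼 n), mem_sphere_zero_iff_norm.2 h1⟩ : sphere (0 : 𝔼 n) 1) =
        β ⟨w, hw⟩ := Subtype.ext (hβ w hw hm).symm
    rw [h2, hφ, Homeomorph.trans_apply, Homeomorph.symm_apply_apply, hβ₀ w hw hm₀]
  -- the two closed pieces `A = k(B̄(0, 1))`, `C = S ∖ k(B(0, 1))`
  have hAc : IsClosed (k '' closedBall (0 : 𝔼 n) 1) :=
    ((isCompact_closedBall _ _).image_of_continuousOn (hkc.mono h12)).isClosed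
  have hCc : IsClosed (k '' ball (0 : 𝔼 n) 1)ᶜ := (hko 1 one_pos one_le_two).isClosed_compl
  have hAC : k '' closedBall (0 : 𝔼 n) 1 ∪ (k '' ball (0 : 𝔼 n) 1)ᶜ = univ := by
    refine eq_univ_of_forall fun z ↦ ?_
    by_cases hz : z ∈ k '' closedBall (0 : 𝔼 n) 1
    · exact Or.inl hz
    · exact Or.inr fun hz' ↦ hz (image_mono ball_subset_closedBall hz')
  have hnotC : ∀ {z}, z ∉ (k '' ball (0 : 𝔼 n) 1)ᶜ → ∃ w ∈ ball (0 : 𝔼 n) 1, k w = z := fun hz ↦ by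
    simpa using hz
  -- `k` restricted to the closed unit ball is a homeomorphism onto `A`
  haveI : CompactSpace (closedBall (0 : 𝔼 n) 1) :=
    isCompact_iff_compactSpace.1 (isCompact_closedBall _ _)
  set e₁f : closedBall (0 : 𝔼 n) 1 → ↥(k '' closedBall (0 : 𝔼 n) 1) :=
    fun w ↦ ⟨k w, w, w.2, rfl⟩ with he₁f
  have he₁c : Continuous e₁f :=
    ((hkc.mono h12).comp_continuous continuous_subtype_val fun w ↦ w.2).subtype_mk _
  have he₁b : Bijective e₁f := by
    refine ⟨fun w₁ w₂ h ↦ Subtype.ext (hki (h12 w₁.2) (h12 w₂.2) (congrArg Subtype.val h)), ?_⟩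
    rintro ⟨z, w, hw, rfl⟩
    exact ⟨⟨w, hw⟩, rfl⟩
  set e₁ := Continuous.homeoOfEquivCompactToT2 (f := Equiv.ofBijective e₁f he₁b) he₁c with he₁
  have he₁s : ∀ w (hw : w ∈ closedBall (0 : 𝔼 n) 1),
      e₁.symm ⟨k w, w, hw, rfl⟩ = ⟨w, hw⟩ := fun w hw ↦ by
    rw [Homeomorph.symm_apply_eq]; rfl
  -- the map
  set F : S → S := fun z ↦ if hz : z ∈ k '' closedBall (0 : 𝔼 n) 1 then k₀ (e₁.symm ⟨z, hz⟩)
    else if hz' : z ∈ (k '' ball (0 : 𝔼 n) 1)ᶜ then (Ω ⟨z, hz'⟩ : S) else z with hF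
  have hFin : ∀ w ∈ closedBall (0 : 𝔼 n) 1, F (k w) = k₀ w := by
    intro w hw
    have : k w ∈ k '' closedBall (0 : 𝔼 n) 1 := ⟨w, hw, rfl⟩
    simp only [hF, this, dif_pos, he₁s w hw]
  have hFout : ∀ z (hz : z ∈ (k '' ball (0 : 𝔼 n) 1)ᶜ), F z = Ω ⟨z, hz⟩ := by
    intro z hz
    by_cases hzA : z ∈ k '' closedBall (0 : 𝔼 n) 1
    · -- on the common boundary sphere the two prescriptions agree
      obtain ⟨w, hw, rfl⟩ := hzA
      have hws : w ∈ sphere (0 : 𝔼 n) 1 := by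
        refine mem_sphere_zero_iff_norm.2 (le_antisymm (mem_closedBall_zero_iff.1 hw) ?_)
        by_contra hlt
        exact hz ⟨w, mem_ball_zero_iff.2 (not_le.1 hlt), rfl⟩
      have hm₀ : k₀ w ∈ (k₀ '' ball (0 : 𝔼 n) 1)ᶜ := by
        rintro ⟨v, hv, hvw⟩
        have h := hk₀i (h12 (ball_subset_closedBall hv)) (h12 hw) hvw
        rw [h, mem_ball_zero_iff, mem_sphere_zero_iff_norm.1 hws] at hv
        exact lt_irrefl _ hv
      rw [hFin w hw, hΩk w hws hz hm₀]
    · simp only [hF, hzA, dif_neg, not_false_eq_true, hz, dif_pos]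
  -- continuity, by pasting along the closed cover
  have hcontA : ContinuousOn F (k '' closedBall (0 : 𝔼 n) 1) := by
    rw [continuousOn_iff_continuous_restrict]
    have heq : (k '' closedBall (0 : 𝔼 n) 1).restrict F = fun z ↦ k₀ (e₁.symm z) := by
      funext z
      simp only [restrict_apply, hF, z.2, dif_pos]
    rw [heq]
    exact (hk₀c.mono h12).comp_continuous (continuous_subtype_val.comp e₁.symm.continuous)
      fun z ↦ (e₁.symm z).2
  have hcontC : ContinuousOn F (k '' ball (0 : 𝔼 n) 1)ᶜ := by
    rw [continuousOn_iff_continuous_restrict]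
    have heq : (k '' ball (0 : 𝔼 n) 1)ᶜ.restrict F = fun z ↦ (Ω z : S) :=
      funext fun z ↦ hFout z z.2
    rw [heq]
    exact continuous_subtype_val.comp Ω.continuous
  have hcont : Continuous F := by
    rw [← continuousOn_univ, ← hAC]
    exact hcontA.union_of_isClosed hcontC hAc hCc
  -- bijectivity
  have hinj : Injective F := by
    intro z₁ z₂ h
    by_cases h₁ : z₁ ∈ (k '' ball (0 : 𝔼 n) 1)ᶜ <;> by_cases h₂ : z₂ ∈ (k '' ball (0 : 𝔼 n) 1)ᶜ
    · rw [hFout z₁ h₁, hFout z₂ h₂] at h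
      exact congrArg Subtype.val (Ω.injective (Subtype.ext h))
    · obtain ⟨w₂, hw₂, rfl⟩ := hnotC h₂
      rw [hFout z₁ h₁, hFin w₂ (ball_subset_closedBall hw₂)] at h
      exact absurd ⟨w₂, hw₂, h.symm⟩ (Ω ⟨z₁, h₁⟩).2
    · obtain ⟨w₁, hw₁, rfl⟩ := hnotC h₁
      rw [hFout z₂ h₂, hFin w₁ (ball_subset_closedBall hw₁)] at h
      exact absurd ⟨w₁, hw₁, h⟩ (Ω ⟨z₂, h₂⟩).2
    · obtain ⟨w₁, hw₁, rfl⟩ := hnotC h₁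
      obtain ⟨w₂, hw₂, rfl⟩ := hnotC h₂
      rw [hFin w₁ (ball_subset_closedBall hw₁), hFin w₂ (ball_subset_closedBall hw₂)] at h
      rw [hk₀i (h12 (ball_subset_closedBall hw₁)) (h12 (ball_subset_closedBall hw₂)) h]
  have hsurj : Surjective F := by
    intro y
    by_cases hy : y ∈ (k₀ '' ball (0 : 𝔼 n) 1)ᶜ
    · refine ⟨(Ω.symm ⟨y, hy⟩ : S), ?_⟩
      rw [hFout _ (Ω.symm ⟨y, hy⟩).2, Subtype.coe_eta, Homeomorph.apply_symm_apply]
    · obtain ⟨w, hw, rfl⟩ : ∃ w ∈ ball (0 : 𝔼 n) 1, k₀ w = y := by simpa using hy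
      exact ⟨k w, hFin w (ball_subset_closedBall hw)⟩
  exact ⟨Continuous.homeoOfEquivCompactToT2 (f := Equiv.ofBijective F ⟨hinj, hsurj⟩) hcont,
    fun w hw ↦ hFin w hw⟩

/-! ### Step 2. The radial reparametrisation `σ` of the punctured ball onto an exterior region -/

section Radial

variable {a b c : ℝ}

/-- The radial profile `γ(s) = max (b / s) (b − (b − c)(s − 1))` of the reparametrisation `σ`:
for `0 < c < b` it is continuous and strictly decreasing in `s > 0`, `γ(1) = b`, `γ ≥ c` on
`(0, 2]`, and `γ(s) ≥ b / s → ∞` as `s → 0⁺`. [folklore] -/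
def endProfile (b c s : ℝ) : ℝ := max (b / s) (b - (b - c) * (s - 1))

/-- `γ(1) = b`. [folklore] -/
@[simp] theorem endProfile_one : endProfile b c 1 = b := by simp [endProfile]

/-- `b / s ≤ γ(s)`. [folklore] -/
theorem div_le_endProfile (s : ℝ) : b / s ≤ endProfile b c s := le_max_left _ _

/-- `γ ≥ c` on `s ≤ 2` (when `c ≤ b`). [folklore] -/
theorem le_endProfile (hcb : c ≤ b) {s : ℝ} (hs : s ≤ 2) : c ≤ endProfile b c s := by
  refine le_max_of_le_right ?_
  have h : (b - c) * (s - 1) ≤ (b - c) * 1 :=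
    mul_le_mul_of_nonneg_left (by linarith) (sub_nonneg.2 hcb)
  linarith

/-- `γ` is strictly decreasing on `(0, ∞)` (when `0 < b`, `c < b`). [folklore] -/
theorem strictAntiOn_endProfile (hb : 0 < b) (hcb : c < b) :
    StrictAntiOn (endProfile b c) (Ioi 0) := by
  intro s hs t _ hst
  refine max_lt_max (div_lt_div_of_pos_left hb hs hst) ?_
  nlinarith [mul_lt_mul_of_pos_left hst (sub_pos.2 hcb)]

/-- `γ` is continuous at every `s ≠ 0`. [folklore] -/
theorem continuousAt_endProfile {s : ℝ} (hs : s ≠ 0) : ContinuousAt (endProfile b c) s := by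
  unfold endProfile
  have h2 : Continuous fun s : ℝ ↦ b - (b - c) * (s - 1) := by fun_prop
  exact (continuousAt_const.div continuousAt_id hs).max h2.continuousAt

/-- `γ(b / Y) = Y` for `Y ≥ b` (when `0 < b`, `0 ≤ c`): the explicit inverse of `γ` on `(0, 1]`.
[folklore] -/
theorem endProfile_div (hb : 0 < b) (hc : 0 ≤ c) {Y : ℝ} (hY : b ≤ Y) :
    endProfile b c (b / Y) = Y := by
  have hYpos : 0 < Y := hb.trans_le hY
  unfold endProfile
  rw [div_div_cancel₀ hb.ne', max_eq_left]
  -- `b - (b - c)(b/Y - 1) = b + (b - c)(Y - b)/Y ≤ Y`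
  rw [show b - (b - c) * (b / Y - 1) = b + (b - c) * (Y - b) / Y by
    field_simp; ring]
  rw [← sub_nonneg, show Y - (b + (b - c) * (Y - b) / Y) = (Y - b) * (Y - b + c) / Y by
    field_simp; ring]
  positivity

variable {n : ℕ}

/-- The radial reparametrisation `σ(x) = (γ(‖x‖) / ‖x‖) x` of `ℝⁿ ∖ {0}`: it carries the punctured
closed ball `B̄(0, 2) ∖ {0}` injectively into the exterior region `{‖y‖ ≥ c}`, the unit sphere onto
the sphere of radius `b`, the punctured unit ball onto `{‖y‖ > b}` (explicit inverse
`exists_endRadialMap_eq`), and `x → 0` to `‖σ x‖ → ∞`. [folklore] -/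
def endRadialMap (b c : ℝ) (x : 𝔼 n) : 𝔼 n := (endProfile b c ‖x‖ / ‖x‖) • x

/-- `‖σ x‖ = γ(‖x‖)` wherever `γ(‖x‖) ≥ 0`, `x ≠ 0`. [folklore] -/
theorem norm_endRadialMap {x : 𝔼 n} (hx : x ≠ 0) (hpos : 0 ≤ endProfile b c ‖x‖) :
    ‖endRadialMap b c x‖ = endProfile b c ‖x‖ := by
  rw [endRadialMap, norm_smul, Real.norm_of_nonneg (div_nonneg hpos (norm_nonneg _)),
    div_mul_cancel₀ _ (norm_ne_zero_iff.2 hx)]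

/-- On the punctured ball `B̄(0, 2) ∖ {0}`: `c ≤ ‖σ x‖` (when `c ≤ b`, `0 ≤ c`). [folklore] -/
theorem le_norm_endRadialMap (hcb : c ≤ b) (hc : 0 ≤ c) {x : 𝔼 n} (hx : x ≠ 0) (hx2 : ‖x‖ ≤ 2) :
    c ≤ ‖endRadialMap b c x‖ := by
  rw [norm_endRadialMap hx (hc.trans (le_endProfile hcb hx2))]
  exact le_endProfile hcb hx2

/-- On the punctured ball `B̄(0, 2) ∖ {0}`: `b / ‖x‖ ≤ ‖σ x‖` (when `c ≤ b`, `0 ≤ c`). [folklore] -/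
theorem div_norm_le_norm_endRadialMap (hcb : c ≤ b) (hc : 0 ≤ c) {x : 𝔼 n} (hx : x ≠ 0)
    (hx2 : ‖x‖ ≤ 2) : b / ‖x‖ ≤ ‖endRadialMap b c x‖ := by
  rw [norm_endRadialMap hx (hc.trans (le_endProfile hcb hx2))]
  exact div_le_endProfile _

/-- `σ` is continuous at every `x ≠ 0`. [folklore] -/
theorem continuousAt_endRadialMap {x : 𝔼 n} (hx : x ≠ 0) :
    ContinuousAt (endRadialMap b c : 𝔼 n → 𝔼 n) x := by
  have h1 : ContinuousAt (fun y : 𝔼 n ↦ endProfile b c ‖y‖) x :=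
    (continuousAt_endProfile (norm_ne_zero_iff.2 hx)).comp continuous_norm.continuousAt
  exact (h1.div continuous_norm.continuousAt (norm_ne_zero_iff.2 hx)).smul continuousAt_id

/-- `σ` is injective on the punctured ball `B̄(0, 2) ∖ {0}` (when `0 < c < b`). [folklore] -/
theorem injOn_endRadialMap (hb : 0 < b) (hcb : c < b) (hc : 0 < c) :
    InjOn (endRadialMap b c : 𝔼 n → 𝔼 n) (closedBall 0 2 \ {0}) := by
  rintro x ⟨hx2, hx⟩ x' ⟨hx2', hx'⟩ h
  rw [mem_closedBall_zero_iff] at hx2 hx2'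
  have hx0 : x ≠ 0 := hx
  have hx0' : x' ≠ 0 := hx'
  have hpos : 0 < endProfile b c ‖x‖ := hc.trans_le (le_endProfile hcb.le hx2)
  have hpos' : 0 < endProfile b c ‖x'‖ := hc.trans_le (le_endProfile hcb.le hx2')
  -- equal norms, hence equal radii, hence equal scalars
  have hn : ‖x‖ = ‖x'‖ := by
    have h1 := congrArg norm h
    rw [norm_endRadialMap hx0 hpos.le, norm_endRadialMap hx0' hpos'.le] at h1
    exact (strictAntiOn_endProfile hb hcb).injOn (norm_pos_iff.2 hx0) (norm_pos_iff.2 hx0') h1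
  have hsc : endProfile b c ‖x‖ / ‖x‖ ≠ 0 := div_ne_zero hpos.ne' (norm_ne_zero_iff.2 hx0)
  rw [endRadialMap, endRadialMap, ← hn] at h
  exact smul_right_injective _ hsc h

/-- **The explicit inverse of `σ` over the exterior `{‖y‖ ≥ b}`**: for `‖y‖ ≥ b` the point
`w = (b / ‖y‖²) y` has `‖w‖ = b / ‖y‖ ∈ (0, 1]`, and `σ w = y` (when `0 < b`, `0 ≤ c`).
[folklore] -/
theorem exists_endRadialMap_eq (hb : 0 < b) (hc : 0 ≤ c) {y : 𝔼 n} (hy : b ≤ ‖y‖) :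
    ∃ w : 𝔼 n, w ≠ 0 ∧ ‖w‖ = b / ‖y‖ ∧ endRadialMap b c w = y := by
  have hYpos : 0 < ‖y‖ := hb.trans_le hy
  have hy0 : y ≠ 0 := norm_pos_iff.1 hYpos
  set s := b / ‖y‖ with hs
  have hspos : 0 < s := div_pos hb hYpos
  refine ⟨(s / ‖y‖) • y, ?_, ?_, ?_⟩
  · exact smul_ne_zero (div_pos hspos hYpos).ne' hy0
  · rw [norm_smul, Real.norm_of_nonneg (div_pos hspos hYpos).le, div_mul_cancel₀ _ hYpos.ne']
  · have hnorm : ‖(s / ‖y‖) • y‖ = s := by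
      rw [norm_smul, Real.norm_of_nonneg (div_pos hspos hYpos).le, div_mul_cancel₀ _ hYpos.ne']
    rw [endRadialMap, hnorm, smul_smul, hs, endProfile_div hb hc hy]
    rw [show ‖y‖ / (b / ‖y‖) * (b / ‖y‖ / ‖y‖) = 1 by field_simp, one_smul]

/-- `‖σ x‖ → ∞` as `x → 0` (when `0 < b`, `0 ≤ c ≤ b`). [folklore] -/
theorem tendsto_endRadialMap_cobounded (hb : 0 < b) (hcb : c ≤ b) (hc : 0 ≤ c) :
    Tendsto (endRadialMap b c : 𝔼 n → 𝔼 n) (𝓝[≠] 0) (cobounded (𝔼 n)) := by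
  rw [← tendsto_norm_atTop_iff_cobounded]
  have h1 : Tendsto (fun x : 𝔼 n ↦ b * ‖x‖⁻¹) (𝓝[≠] 0) atTop :=
    (tendsto_inv_nhdsGT_zero.comp tendsto_norm_nhdsNE_zero).const_mul_atTop hb
  refine tendsto_atTop_mono' _ ?_ h1
  have h2 : ∀ᶠ x : 𝔼 n in 𝓝[≠] 0, x ∈ closedBall (0 : 𝔼 n) 2 :=
    mem_nhdsWithin_of_mem_nhds (closedBall_mem_nhds _ two_pos)
  filter_upwards [h2, self_mem_nhdsWithin] with x hx2 hx
  rw [← div_eq_mul_inv]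
  exact div_norm_le_norm_endRadialMap hcb hc hx (mem_closedBall_zero_iff.1 hx2)

end Radial

/-! ### Step 3. The collar read in the sphere `S ≅ ℝⁿ ∪ {∞}` through `σ` -/

section Collar

variable {n : ℕ} {S : Type*} [TopologicalSpace S]

/-- The collar `φ` read in the sphere through `σ`: `k(x) = Θ(φ(σ x))` for `x ≠ 0` and
`k(0) = Θ ∞`, for a homeomorphism `Θ : ℝⁿ ∪ {∞} ≅ S`. For `φ = id` this is the exterior region
`{‖y‖ ≥ γ(2)}` with the point at infinity filled in, parametrised by the ball `B̄(0, 2)`.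
[folklore] -/
def collarSphereMap (Θ : OnePoint (𝔼 n) ≃ₜ S) (φ : 𝔼 n → 𝔼 n) (b c : ℝ) (x : 𝔼 n) : S :=
  if x = 0 then Θ OnePoint.infty else Θ (φ (endRadialMap b c x))

variable (Θ : OnePoint (𝔼 n) ≃ₜ S) {φ : 𝔼 n → 𝔼 n} {a b c : ℝ}

/-- `k(0) = Θ ∞`. [folklore] -/
@[simp] theorem collarSphereMap_zero : collarSphereMap Θ φ b c 0 = Θ OnePoint.infty := by
  simp [collarSphereMap]

/-- `k(x) = Θ(φ(σ x))` for `x ≠ 0`. [folklore] -/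
theorem collarSphereMap_of_ne {x : 𝔼 n} (hx : x ≠ 0) :
    collarSphereMap Θ φ b c x = Θ (φ (endRadialMap b c x)) := by
  simp [collarSphereMap, hx]

/-- On the punctured ball `B̄(0, 2) ∖ {0}`, `σ` lands in the open region `{a < ‖y‖}` where `φ` is an
embedding (when `a < c ≤ b`, `0 ≤ c`). [folklore] -/
theorem lt_norm_endRadialMap (hac : a < c) (hcb : c ≤ b) (hc : 0 ≤ c) {x : 𝔼 n} (hx : x ≠ 0)
    (hx2 : ‖x‖ ≤ 2) : a < ‖endRadialMap b c x‖ :=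
  hac.trans_le (le_norm_endRadialMap hcb hc hx hx2)

/-- `{a ≤ ‖y‖}` is a neighbourhood of every point of `{a < ‖y‖}`. [folklore] -/
theorem setOf_le_norm_mem_nhds {y : 𝔼 n} (hy : a < ‖y‖) : {y : 𝔼 n | a ≤ ‖y‖} ∈ 𝓝 y :=
  mem_of_superset ((isOpen_lt continuous_const continuous_norm).mem_nhds hy) fun _ h ↦
    show a ≤ _ from le_of_lt h

/-- `φ ∘ σ` is continuous at every point of the punctured ball `B̄(0, 2) ∖ {0}`. [folklore] -/
theorem continuousAt_comp_endRadialMap (hac : a < c) (hcb : c ≤ b) (hc : 0 ≤ c)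
    (hφc : ContinuousOn φ {y | a ≤ ‖y‖}) {x : 𝔼 n} (hx : x ≠ 0) (hx2 : ‖x‖ ≤ 2) :
    ContinuousAt (fun x ↦ φ (endRadialMap b c x)) x :=
  ContinuousAt.comp
    (hφc.continuousAt (setOf_le_norm_mem_nhds (lt_norm_endRadialMap hac hcb hc hx hx2)))
    (continuousAt_endRadialMap hx)

/-- `φ ∘ σ` is injective on the punctured ball `B̄(0, 2) ∖ {0}`. [folklore] -/
theorem injOn_comp_endRadialMap (hb : 0 < b) (hac : a < c) (hcb : c < b) (hc : 0 < c)
    (hφi : InjOn φ {y | a ≤ ‖y‖}) :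
    InjOn (fun x ↦ φ (endRadialMap b c x)) (closedBall (0 : 𝔼 n) 2 \ {0}) := by
  intro x hx x' hx' h
  have hxm : a ≤ ‖endRadialMap b c x‖ :=
    (lt_norm_endRadialMap hac hcb.le hc.le hx.2 (mem_closedBall_zero_iff.1 hx.1)).le
  have hxm' : a ≤ ‖endRadialMap b c x'‖ :=
    (lt_norm_endRadialMap hac hcb.le hc.le hx'.2 (mem_closedBall_zero_iff.1 hx'.1)).le
  exact injOn_endRadialMap hb hcb hc hx hx' (hφi hxm hxm' h)

/-- **`k` is continuous on `B̄(0, 2)`**: away from `0` it is `Θ ∘ φ ∘ σ`; at `0`, `‖σ x‖ → ∞`, the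
collar runs out to the end (`φ → ∞` at `∞`), and `y → ∞` in `ℝⁿ ∪ {∞}`. [folklore] -/
theorem continuousOn_collarSphereMap (hb : 0 < b) (hac : a < c) (hcb : c < b) (hc : 0 < c)
    (hφc : ContinuousOn φ {y | a ≤ ‖y‖})
    (hend : Tendsto φ (cobounded (𝔼 n)) (cobounded (𝔼 n))) :
    ContinuousOn (collarSphereMap Θ φ b c) (closedBall 0 2) := by
  intro x hx
  rw [mem_closedBall_zero_iff] at hx
  by_cases hx0 : x = 0
  · subst hx0
    refine ContinuousAt.continuousWithinAt (continuousWithinAt_compl_self.1 ?_)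
    show Tendsto _ _ (𝓝 (collarSphereMap Θ φ b c 0))
    rw [collarSphereMap_zero]
    have hcoe : Tendsto ((↑) : 𝔼 n → OnePoint (𝔼 n)) (cobounded (𝔼 n)) (𝓝 OnePoint.infty) := by
      rw [Metric.cobounded_eq_cocompact, ← Filter.coclosedCompact_eq_cocompact]
      exact OnePoint.tendsto_coe_infty
    have h1 : Tendsto (fun x : 𝔼 n ↦ Θ (φ (endRadialMap b c x))) (𝓝[≠] 0)
        (𝓝 (Θ OnePoint.infty)) :=
      Θ.continuous.continuousAt.tendsto.comp
        (hcoe.comp (hend.comp (tendsto_endRadialMap_cobounded hb hcb.le hc.le)))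
    refine h1.congr' ?_
    filter_upwards [self_mem_nhdsWithin] with y hy
    exact (collarSphereMap_of_ne Θ hy).symm
  · have h1 : ContinuousAt (fun x : 𝔼 n ↦ Θ (φ (endRadialMap b c x))) x :=
      Θ.continuous.continuousAt.comp (OnePoint.continuous_coe.continuousAt.comp
        (continuousAt_comp_endRadialMap hac hcb.le hc.le hφc hx0 hx))
    refine (h1.congr_of_eventuallyEq ?_).continuousWithinAt
    filter_upwards [eventually_ne_nhds hx0] with y hy
    exact collarSphereMap_of_ne Θ hy

/-- **`k` is injective on `B̄(0, 2)`.** [folklore] -/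
theorem injOn_collarSphereMap (hb : 0 < b) (hac : a < c) (hcb : c < b) (hc : 0 < c)
    (hφi : InjOn φ {y | a ≤ ‖y‖}) :
    InjOn (collarSphereMap Θ φ b c) (closedBall 0 2) := by
  intro x hx x' hx' h
  by_cases hx0 : x = 0 <;> by_cases hx0' : x' = 0
  · rw [hx0, hx0']
  · rw [hx0, collarSphereMap_zero, collarSphereMap_of_ne Θ hx0'] at h
    exact absurd (Θ.injective h) (OnePoint.infty_ne_coe _)
  · rw [hx0', collarSphereMap_zero, collarSphereMap_of_ne Θ hx0] at h
    exact absurd (Θ.injective h).symm (OnePoint.infty_ne_coe _)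
  · rw [collarSphereMap_of_ne Θ hx0, collarSphereMap_of_ne Θ hx0'] at h
    exact injOn_comp_endRadialMap hb hac hcb hc hφi ⟨hx, hx0⟩ ⟨hx', hx0'⟩
      (OnePoint.coe_injective (Θ.injective h))

/-- The image of a ball under `k`: the point at infinity together with `φ(σ(B(0, r) ∖ {0}))`.
[folklore] -/
theorem image_ball_collarSphereMap {r : ℝ} (hr : 0 < r) :
    collarSphereMap Θ φ b c '' ball 0 r = Θ '' (insert OnePoint.infty
      (((↑) : 𝔼 n → OnePoint (𝔼 n)) ''
        ((fun x ↦ φ (endRadialMap b c x)) '' (ball 0 r \ {0})))) := by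
  ext z
  constructor
  · rintro ⟨x, hx, rfl⟩
    by_cases hx0 : x = 0
    · subst hx0
      exact ⟨OnePoint.infty, mem_insert _ _, (collarSphereMap_zero Θ).symm⟩
    · exact ⟨_, mem_insert_of_mem _ ⟨φ (endRadialMap b c x), ⟨x, ⟨hx, hx0⟩, rfl⟩, rfl⟩,
        (collarSphereMap_of_ne Θ hx0).symm⟩
  · rintro ⟨u, hu, rfl⟩
    rcases mem_insert_iff.1 hu with rfl | ⟨y, ⟨x, ⟨hx, hx0⟩, rfl⟩, rfl⟩
    · exact ⟨0, mem_ball_self hr, collarSphereMap_zero Θ⟩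
    · exact ⟨x, hx, collarSphereMap_of_ne Θ hx0⟩

/-- **`k(B(0, r))` is open for `0 < r ≤ 2`.** Its trace on `ℝⁿ` is `V = φ(σ(B(0, r) ∖ {0}))`, open
by invariance of domain (the tree's `Brouwer.isOpen_image_of_injOn`), and it contains `∞` with
`ℝⁿ ∖ V` compact: `ℝⁿ ∖ V` is closed, and bounded because `V ⊇ φ({‖y‖ > max(b, b/r)})` (explicit
inverse of `σ`) while `ℝⁿ ∖ φ({a ≤ ‖y‖})` is bounded and `φ({a ≤ ‖y‖ ≤ M})` is compact.
[folklore] -/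
theorem isOpen_image_collarSphereMap (hb : 0 < b) (hac : a < c) (hcb : c < b) (hc : 0 < c)
    (hφc : ContinuousOn φ {y | a ≤ ‖y‖}) (hφi : InjOn φ {y | a ≤ ‖y‖})
    (hK : IsBounded (φ '' {y : 𝔼 n | a ≤ ‖y‖})ᶜ) {r : ℝ} (hr : 0 < r) (hr2 : r ≤ 2) :
    IsOpen (collarSphereMap Θ φ b c '' ball 0 r) := by
  set V := (fun x ↦ φ (endRadialMap b c x)) '' (ball (0 : 𝔼 n) r \ {0}) with hV
  have hsub : ball (0 : 𝔼 n) r \ {0} ⊆ closedBall 0 2 \ {0} := fun x hx ↦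
    ⟨ball_subset_closedBall.trans (closedBall_subset_closedBall hr2) hx.1, hx.2⟩
  -- `V` is open (invariance of domain)
  have hVo : IsOpen V := by
    refine Literature.Topology.Euclidean.Brouwer.isOpen_image_of_injOn rfl
      (isOpen_ball.sdiff isClosed_singleton) (fun x hx ↦ ?_)
      ((injOn_comp_endRadialMap hb hac hcb hc hφi).mono hsub)
    exact (continuousAt_comp_endRadialMap hac hcb.le hc.le hφc hx.2
      (mem_closedBall_zero_iff.1 (hsub hx).1)).continuousWithinAt
  -- `ℝⁿ ∖ V` is bounded
  set M := max b (b / r) with hM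
  have hVb : IsBounded Vᶜ := by
    have hcpt : IsCompact (φ '' ({y : 𝔼 n | a ≤ ‖y‖} ∩ closedBall 0 M)) :=
      ((isCompact_closedBall 0 M).inter_left (isClosed_le continuous_const continuous_norm)
        ).image_of_continuousOn (hφc.mono inter_subset_left)
    refine (hK.union hcpt.isBounded).subset fun z hz ↦ ?_
    by_cases hz' : z ∈ φ '' {y : 𝔼 n | a ≤ ‖y‖}
    · obtain ⟨y, hy, rfl⟩ := hz'
      refine Or.inr ⟨y, ⟨hy, mem_closedBall_zero_iff.2 ?_⟩, rfl⟩
      by_contra hlt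
      rw [not_le] at hlt
      have hyb : b ≤ ‖y‖ := (le_max_left _ _).trans hlt.le
      have hYpos : 0 < ‖y‖ := hb.trans_le hyb
      obtain ⟨w, hw0, hwn, hwy⟩ := exists_endRadialMap_eq (n := n) hb hc.le hyb
      refine hz ⟨w, ⟨mem_ball_zero_iff.2 ?_, hw0⟩, by simp only [hwy]⟩
      rw [hwn, div_lt_iff₀ hYpos]
      have h1 : b / r < ‖y‖ := (le_max_right _ _).trans_lt hlt
      rw [div_lt_iff₀ hr] at h1
      linarith [mul_comm r ‖y‖]
    · exact Or.inl hz'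
  have hVc : IsCompact Vᶜ := Metric.isCompact_of_isClosed_isBounded hVo.isClosed_compl hVb
  -- hence `{∞} ∪ V` is open in `ℝⁿ ∪ {∞}`
  have hU : IsOpen (insert OnePoint.infty (((↑) : 𝔼 n → OnePoint (𝔼 n)) '' V)) := by
    rw [OnePoint.isOpen_iff_of_mem (mem_insert _ _)]
    have hpre : ((↑) : 𝔼 n → OnePoint (𝔼 n)) ⁻¹'
        (insert OnePoint.infty (((↑) : 𝔼 n → OnePoint (𝔼 n)) '' V)) = V := by
      ext y
      simp only [mem_preimage, mem_insert_iff, OnePoint.coe_ne_infty, false_or]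
      exact OnePoint.coe_injective.mem_set_image
    rw [hpre]
    exact ⟨hVo.isClosed_compl, hVc⟩
  rw [image_ball_collarSphereMap Θ hr]
  exact Θ.isOpenMap _ hU

end Collar

/-! ### Step 4. The theorem -/

/-- **A topological product structure near the end of `ℝⁿ` extends to a global radial coordinate**
(`n ≥ 2`). Let `φ` be a closed collar of the end of `ℝⁿ`: a map continuous and injective on an
exterior region `{‖y‖ ≥ a}`, running out to the end (`φ(y) → ∞` as `y → ∞`), whose image is a
neighbourhood of the end (`ℝⁿ ∖ φ({‖y‖ ≥ a})` bounded). Then for every `b > a` (`b > 0`) some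
homeomorphism `G` of `ℝⁿ` agrees with `φ` on `{‖y‖ ≥ b}` — so `ρ = ‖G⁻¹ ·‖` is a topological
radial function ("a homeomorphism followed by the usual radius function", DeMichelis–Freedman
p. 246) whose levels `{ρ = s}`, `s ≥ b`, are the levels `φ(∂B(0, s))` of the product structure.
This is the last step of the proof of DeMichelis–Freedman's Thm. 3.2 (p. 246: "it is a simple matter
to find a topological product structure near end(`R⁴₁`) […]. The Schoenflies theorem allows this
product structure near infinity to be extended to a global radial coordinate."), for `ℝⁿ` itself;
the version for a space homeomorphic to `ℝⁿ` (there: the ribbon `ℝ⁴`, homeomorphic to `ℝ⁴` by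
Thm. 3.1 (3)) is `exists_homeomorph_eq_of_endCollar_of_homeomorph`. Proof, as printed, by the
generalized Schoenflies theorem (Brown): in `S = ℝⁿ ∪ {∞} ≅ Sⁿ` the level `φ(∂B(0, b))` is a
bicollared sphere, so the closure `ℝⁿ ∖ φ({‖y‖ > b})` of its bounded side is an `n`-cell; read
through the radial reparametrisation `σ` (Step 2) the collar with `∞` filled in and the standard
exterior are two tame balls `k`, `k₀` in `S` (Step 3), which some homeomorphism `F` of `S` matches,
`F ∘ k = k₀` on `B̄(0, 1)` (Step 1: Schoenflies twice, Alexander trick, pasting); `F` fixes `∞`,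
descends to `H : ℝⁿ ≅ ℝⁿ` with `H ∘ φ = id` on `{‖y‖ ≥ b}`, and `G = H⁻¹`.
[cite: DeMichelisFreedman1992, §3, proof of Thm. 3.2, p. 246, lines 1–4] -/
theorem exists_homeomorph_eq_of_endCollar (hn : 2 ≤ n) {a b : ℝ} (hab : a < b) (hb : 0 < b)
    {φ : 𝔼 n → 𝔼 n} (hφc : ContinuousOn φ {y | a ≤ ‖y‖}) (hφi : InjOn φ {y | a ≤ ‖y‖})
    (hend : Tendsto φ (cobounded (𝔼 n)) (cobounded (𝔼 n)))
    (hK : IsBounded (φ '' {y | a ≤ ‖y‖})ᶜ) :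
    ∃ G : 𝔼 n ≃ₜ 𝔼 n, ∀ y, b ≤ ‖y‖ → G y = φ y := by
  -- the auxiliary radius `c`: `max a 0 < c < b`
  set c := (max a 0 + b) / 2 with hc_def
  have hmax : max a 0 < b := max_lt hab hb
  have hac : a < c := by rw [hc_def]; linarith [le_max_left a 0]
  have hc0 : 0 < c := by rw [hc_def]; linarith [le_max_right a 0]
  have hcb : c < b := by rw [hc_def]; linarith
  -- the round sphere `S ≅ ℝⁿ ∪ {∞}` and the embedding `j` of `ℝⁿ`
  haveI : Fact (Module.finrank ℝ (𝔼 (n + 1)) = n + 1) := ⟨by simp⟩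
  have hS : IsTopSphere n (sphere (0 : 𝔼 (n + 1)) 1) := isTopSphere_sphere
  set Θ : OnePoint (𝔼 n) ≃ₜ sphere (0 : 𝔼 (n + 1)) 1 :=
    onePointEquivSphereOfFinrankEq (by simp) with hΘ
  set j : 𝔼 n → sphere (0 : 𝔼 (n + 1)) 1 := fun v ↦ Θ (v : OnePoint (𝔼 n)) with hj'
  have hj : IsOpenEmbedding j := Θ.isOpenEmbedding.comp OnePoint.isOpenEmbedding_coe
  have hrange : range j = {Θ OnePoint.infty}ᶜ := by
    rw [show j = Θ ∘ ((↑) : 𝔼 n → OnePoint (𝔼 n)) from rfl, range_comp, ← OnePoint.compl_infty,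
      Homeomorph.image_compl, image_singleton]
  -- the two tame balls: the collar `k` and the standard exterior `k₀`, with `∞` filled in
  have hidc : ContinuousOn (id : 𝔼 n → 𝔼 n) {y | a ≤ ‖y‖} := continuousOn_id
  have hidi : InjOn (id : 𝔼 n → 𝔼 n) {y | a ≤ ‖y‖} := injOn_id _
  have hidK : IsBounded ((id : 𝔼 n → 𝔼 n) '' {y | a ≤ ‖y‖})ᶜ := by
    rw [image_id]
    refine (isBounded_ball (x := (0 : 𝔼 n)) (r := a)).subset fun y hy ↦ ?_
    rw [mem_compl_iff, mem_setOf_eq, not_le] at hy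
    exact mem_ball_zero_iff.2 hy
  obtain ⟨F, hF⟩ := exists_homeomorph_sphere_two_balls hS hn
    (continuousOn_collarSphereMap Θ hb hac hcb hc0 hφc hend)
    (injOn_collarSphereMap Θ hb hac hcb hc0 hφi)
    (fun r hr hr2 ↦ isOpen_image_collarSphereMap Θ hb hac hcb hc0 hφc hφi hK hr hr2)
    (continuousOn_collarSphereMap Θ hb hac hcb hc0 hidc tendsto_id)
    (injOn_collarSphereMap Θ hb hac hcb hc0 hidi)
    (fun r hr hr2 ↦ isOpen_image_collarSphereMap Θ hb hac hcb hc0 hidc hidi hidK hr hr2)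
  -- `F` fixes `∞ = k(0) = k₀(0)` and descends to `ℝⁿ`
  have hFN : F (Θ OnePoint.infty) = Θ OnePoint.infty := by
    have h := hF 0 (mem_closedBall_self zero_le_one)
    rwa [collarSphereMap_zero, collarSphereMap_zero] at h
  obtain ⟨H, hH⟩ := exists_homeomorph_conj_of_apply_eq hj.toIsEmbedding hrange F hFN
  refine ⟨H.symm, fun y hy ↦ ?_⟩
  -- `y = σ w` with `0 < ‖w‖ ≤ 1`, so `F (Θ (φ y)) = F (k w) = k₀ w = Θ y`
  obtain ⟨w, hw0, hwn, hwy⟩ := exists_endRadialMap_eq (n := n) hb hc0.le hy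
  have hw1 : w ∈ closedBall (0 : 𝔼 n) 1 :=
    mem_closedBall_zero_iff.2 (by rw [hwn]; exact div_le_one_of_le₀ hy (norm_nonneg _))
  have h1 := hF w hw1
  rw [collarSphereMap_of_ne Θ hw0, collarSphereMap_of_ne Θ hw0, hwy, id] at h1
  have h2 : j (H (φ y)) = j y := by rw [hH]; exact h1
  rw [Homeomorph.symm_apply_eq]
  exact (hj.injective h2).symm

/-- **Thm. 3.2, last step: a topological product structure near the end of a space homeomorphic to
`ℝⁿ` extends to a global radial coordinate** (`n ≥ 2`). Let `R ≅ ℝⁿ` (by `e`; in DeMichelis–Freedman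
`R = R⁴₁` is a ribbon `ℝ⁴`, homeomorphic to `ℝ⁴` by Thm. 3.1 (3)) and let `φ` be a closed collar of
the end of `R` ("a topological product structure near end(`R`)", its levels being the spheres
`φ(∂B(0, s))`): continuous and injective on `{‖y‖ ≥ a}`, running out to the end of `R`
(`φ(y) → ∞`, i.e. `φ` tends to the cocompact filter), with image a neighbourhood of the end
(`R ∖ φ({‖y‖ ≥ a})` relatively compact). Then for every `b > a`, `b > 0`, there is a homeomorphism
`G : ℝⁿ ≅ R` with `G = φ` on `{‖y‖ ≥ b}`: the topological radial function `ρ = ‖G⁻¹ ·‖` of `R`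
extends the product structure near infinity (`exists_homeomorph_norm_symm_eq_of_endCollar`).
[cite: DeMichelisFreedman1992, §3, proof of Thm. 3.2, p. 246, lines 1–4] -/
theorem exists_homeomorph_eq_of_endCollar_of_homeomorph {R : Type*} [TopologicalSpace R]
    (e : R ≃ₜ 𝔼 n) (hn : 2 ≤ n) {a b : ℝ} (hab : a < b) (hb : 0 < b) {φ : 𝔼 n → R}
    (hφc : ContinuousOn φ {y | a ≤ ‖y‖}) (hφi : InjOn φ {y | a ≤ ‖y‖})
    (hend : Tendsto φ (cobounded (𝔼 n)) (cocompact R))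
    (hK : ∃ K, IsCompact K ∧ (φ '' {y | a ≤ ‖y‖})ᶜ ⊆ K) :
    ∃ G : 𝔼 n ≃ₜ R, ∀ y, b ≤ ‖y‖ → G y = φ y := by
  obtain ⟨K, hKc, hKsub⟩ := hK
  have h1 : ContinuousOn (e ∘ φ) {y | a ≤ ‖y‖} := e.continuous.comp_continuousOn hφc
  have h2 : InjOn (e ∘ φ) {y | a ≤ ‖y‖} := e.injective.comp_injOn hφi
  have he : Tendsto e (cocompact R) (cobounded (𝔼 n)) := by
    rw [Metric.cobounded_eq_cocompact]
    exact e.map_cocompact.le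
  have h3 : Tendsto (e ∘ φ) (cobounded (𝔼 n)) (cobounded (𝔼 n)) := he.comp hend
  have h4 : IsBounded ((e ∘ φ) '' {y | a ≤ ‖y‖})ᶜ := by
    rw [image_comp, ← Homeomorph.image_compl]
    exact (hKc.image e.continuous).isBounded.subset (image_mono hKsub)
  obtain ⟨G, hG⟩ := exists_homeomorph_eq_of_endCollar hn hab hb h1 h2 h3 h4
  refine ⟨G.trans e.symm, fun y hy ↦ ?_⟩
  rw [Homeomorph.trans_apply, hG y hy, Function.comp_apply, Homeomorph.symm_apply_apply]

/-- **The global radial coordinate extends the product structure near infinity.** With `G` as in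
`exists_homeomorph_eq_of_endCollar_of_homeomorph`, the topological radial function `ρ = ‖G⁻¹ ·‖`
("a homeomorphism followed by the usual radius function") satisfies `ρ(φ y) = ‖y‖` for `‖y‖ ≥ b`,
and for `s ≥ b` its level `{ρ = s}` is the level `φ(∂B(0, s))` of the product structure and its
exterior region `{ρ ≥ s}` is `φ({‖y‖ ≥ s})`.
[cite: DeMichelisFreedman1992, §3, proof of Thm. 3.2, p. 246, lines 1–4] -/
theorem exists_homeomorph_norm_symm_eq_of_endCollar {R : Type*} [TopologicalSpace R]
    (e : R ≃ₜ 𝔼 n) (hn : 2 ≤ n) {a b : ℝ} (hab : a < b) (hb : 0 < b) {φ : 𝔼 n → R}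
    (hφc : ContinuousOn φ {y | a ≤ ‖y‖}) (hφi : InjOn φ {y | a ≤ ‖y‖})
    (hend : Tendsto φ (cobounded (𝔼 n)) (cocompact R))
    (hK : ∃ K, IsCompact K ∧ (φ '' {y | a ≤ ‖y‖})ᶜ ⊆ K) :
    ∃ G : 𝔼 n ≃ₜ R, (∀ y, b ≤ ‖y‖ → G y = φ y) ∧ (∀ y, b ≤ ‖y‖ → ‖G.symm (φ y)‖ = ‖y‖) ∧
      ∀ s, b ≤ s → {x | ‖G.symm x‖ = s} = φ '' sphere 0 s ∧
        {x | s ≤ ‖G.symm x‖} = φ '' {y | s ≤ ‖y‖} := by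
  obtain ⟨G, hG⟩ := exists_homeomorph_eq_of_endCollar_of_homeomorph e hn hab hb hφc hφi hend hK
  have hsymm : ∀ y, b ≤ ‖y‖ → G.symm (φ y) = y := fun y hy ↦ by
    rw [Homeomorph.symm_apply_eq, hG y hy]
  refine ⟨G, hG, fun y hy ↦ by rw [hsymm y hy], fun s hs ↦ ⟨?_, ?_⟩⟩
  · ext x
    constructor
    · intro hx
      have hx' : b ≤ ‖G.symm x‖ := hs.trans (le_of_eq hx.symm)
      exact ⟨G.symm x, mem_sphere_zero_iff_norm.2 hx, by
        rw [← hG _ hx', Homeomorph.apply_symm_apply]⟩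
    · rintro ⟨y, hy, rfl⟩
      have hy' : ‖y‖ = s := mem_sphere_zero_iff_norm.1 hy
      show ‖G.symm (φ y)‖ = s
      rw [hsymm y (hs.trans hy'.ge), hy']
  · ext x
    constructor
    · intro hx
      have hx' : b ≤ ‖G.symm x‖ := hs.trans hx
      exact ⟨G.symm x, hx, by rw [← hG _ hx', Homeomorph.apply_symm_apply]⟩
    · rintro ⟨y, hy, rfl⟩
      show s ≤ ‖G.symm (φ y)‖
      rw [hsymm y (hs.trans hy)]
      exact hy

/-- **Thm. 3.2, last step, in dimension four** (the case of the paper: the ribbon `ℝ⁴` `R⁴₁ ≅ ℝ⁴`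
with a topological product structure near its end, p. 246): the product structure `φ` near
infinity extends to a global radial coordinate — a homeomorphism `G : ℝ⁴ ≅ R` with `G = φ` on
`{‖y‖ ≥ b}`. [cite: DeMichelisFreedman1992, §3, proof of Thm. 3.2, p. 246, lines 1–4] -/
theorem exists_homeomorph_eq_of_endCollar_four {R : Type*} [TopologicalSpace R]
    (e : R ≃ₜ 𝔼 4) {a b : ℝ} (hab : a < b) (hb : 0 < b) {φ : 𝔼 4 → R}
    (hφc : ContinuousOn φ {y | a ≤ ‖y‖}) (hφi : InjOn φ {y | a ≤ ‖y‖})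
    (hend : Tendsto φ (cobounded (𝔼 4)) (cocompact R))
    (hK : ∃ K, IsCompact K ∧ (φ '' {y | a ≤ ‖y‖})ᶜ ⊆ K) :
    ∃ G : 𝔼 4 ≃ₜ R, ∀ y, b ≤ ‖y‖ → G y = φ y :=
  exists_homeomorph_eq_of_endCollar_of_homeomorph e (by norm_num) hab hb hφc hφi hend hK

/-! ### Step 5. "A question of normalization": rescaling the radial function along the
self-similarity of the Cantor set -/

section Normalisation

/-- **Right-third self-similarity of the standard Cantor set**: `t ∈ CS ⇒ (2 + t)/3 ∈ CS`
(Mathlib's `cantorSet_eq_union_halves`). [folklore] -/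
theorem two_add_div_three_mem_cantorSet {t : ℝ} (ht : t ∈ cantorSet) : (2 + t) / 3 ∈ cantorSet := by
  rw [cantorSet_eq_union_halves]
  exact Or.inr ⟨t, ht, rfl⟩

/-- **The final segments `CS ∩ [1 − 3⁻ᵐ, 1]` are scaled copies of `CS`**: `t ∈ CS` implies
`1 − (1 − t)/3ᵐ ∈ CS`. [folklore] -/
theorem one_sub_div_pow_mem_cantorSet {t : ℝ} (ht : t ∈ cantorSet) (m : ℕ) :
    1 - (1 - t) / 3 ^ m ∈ cantorSet := by
  induction m with
  | zero => simpa using ht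
  | succ m ih =>
    have h : 1 - (1 - t) / 3 ^ (m + 1) = (2 + (1 - (1 - t) / 3 ^ m)) / 3 := by ring
    rw [h]
    exact two_add_div_three_mem_cantorSet ih

variable {X : Type*} [TopologicalSpace X] {F : Type*} [NormedAddCommGroup F] [NormedSpace ℝ F]

/-- **Rescaling a topological radial function.** Scaling the polar coordinates `e` of `R` by
`3⁻ᵐ` rescales the radial function `ρ = ‖e ·‖` to `ρ / 3ᵐ` and reparametrises the polar family of
the tree (`polarBall R e t = {(1 − t) ρ < 1}`, `ExoticOpenFourSpacePolarProofs`) along the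
self-similarity `t ↦ 1 − (1 − t)/3ᵐ` of the parameter interval. [folklore] -/
theorem polarBall_trans_smul (R : TopologicalSpace.Opens X) (e : R ≃ₜ F) (m : ℕ) (t : ℝ) :
    polarBall R (e.trans (Homeomorph.smulOfNeZero ((3 : ℝ) ^ m)⁻¹ (by positivity))) t =
      polarBall R e (1 - (1 - t) / 3 ^ m) := by
  ext x
  simp only [SetLike.mem_coe, mem_polarBall, Homeomorph.trans_apply, Homeomorph.smulOfNeZero_apply,
    norm_smul, norm_inv, norm_pow, Real.norm_ofNat, sub_sub_cancel, div_eq_mul_inv, mul_assoc]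

/-- **Thm. 3.2, "a question of normalization".** The proof of Thm. 3.2 ends (p. 246): "The further
conditions of Theorem 3.2 are now just a question of normalization, q.e.d." — the further
conditions being `K ⊂ R⁴₀` and "`R⁴_t` is also a ribbon 4-space for `t` belonging to the standard
Cantor set" (Thm. 3.2, p. 244), while the construction gives them for the Cantor parameters beyond
the radius from which on the global radial coordinate has the levels of the design (pp. 245–246).
The normalisation, spelled out for any property `P` of the polar balls: if `P(R_t)` holds for the
Cantor parameters `t ≥ t₀` of a final segment (`t₀ < 1`) and `K ⊆ R` is compact, then after
rescaling the radial function by `3⁻ᵐ` (`m` large; `polarBall_trans_smul`) — which reparametrises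
the family along the self-similarity `t ↦ 1 − (1 − t)/3ᵐ` of `CS` (`one_sub_div_pow_mem_cantorSet`)
— `P` holds for EVERY Cantor parameter and `K` lies in the unit ball `R_0`.
[cite: DeMichelisFreedman1992, §3, Thm. 3.2 (p. 244) and the last line of its proof (p. 246)] -/
theorem exists_polar_normalisation (R : TopologicalSpace.Opens X) (e : R ≃ₜ F) {K : Set X}
    (hK : IsCompact K) (hKR : K ⊆ R) (P : TopologicalSpace.Opens X → Prop) {t₀ : ℝ} (ht₀ : t₀ < 1)
    (hP : ∀ t ∈ cantorSet, t₀ ≤ t → P (polarBall R e t)) :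
    ∃ (m : ℕ) (e' : R ≃ₜ F), (∀ x, ‖e' x‖ = ‖e x‖ / 3 ^ m) ∧
      (∀ t, polarBall R e' t = polarBall R e (1 - (1 - t) / 3 ^ m)) ∧
      K ⊆ polarBall R e' 0 ∧ ∀ t ∈ cantorSet, P (polarBall R e' t) := by
  -- `ρ = ‖e ·‖` is bounded on the compact `K ⊆ R`
  have hK' : IsCompact ((Subtype.val : R → X) ⁻¹' K) := by
    rw [Topology.IsEmbedding.subtypeVal.isCompact_iff, image_preimage_eq_inter_range,
      Subtype.range_coe, inter_eq_left.2 hKR]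
    exact hK
  obtain ⟨B, hB⟩ := (hK'.image_of_continuousOn
    (continuous_norm.comp e.continuous).continuousOn).isBounded.subset_closedBall 0
  have hB' : ∀ y : R, (y : X) ∈ K → ‖e y‖ ≤ B := fun y hy ↦ by
    have h : ‖(‖e y‖)‖ ≤ B := by
      simpa only [mem_closedBall, dist_zero_right, Function.comp_apply] using hB ⟨y, hy, rfl⟩
    rwa [Real.norm_of_nonneg (norm_nonneg _)] at h
  -- choose `m` with `3ᵐ > B` and `3ᵐ (1 - t₀) > 1`
  obtain ⟨m, hm⟩ := pow_unbounded_of_one_lt (max B (1 / (1 - t₀))) (by norm_num : (1 : ℝ) < 3)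
  have h3 : (0 : ℝ) < 3 ^ m := by positivity
  have hmB : B < 3 ^ m := (le_max_left _ _).trans_lt hm
  have hmt : 1 / (1 - t₀) < 3 ^ m := (le_max_right _ _).trans_lt hm
  set e' : R ≃ₜ F := e.trans (Homeomorph.smulOfNeZero ((3 : ℝ) ^ m)⁻¹ (by positivity)) with he'
  have hnorm : ∀ x, ‖e' x‖ = ‖e x‖ / 3 ^ m := fun x ↦ by
    rw [he', Homeomorph.trans_apply, Homeomorph.smulOfNeZero_apply, norm_smul, norm_inv, norm_pow,
      Real.norm_ofNat, div_eq_inv_mul]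
  refine ⟨m, e', hnorm, polarBall_trans_smul R e m, fun x hx ↦ ?_, fun t ht ↦ ?_⟩
  · -- `K ⊆ R'_0`: `‖e x‖ / 3ᵐ ≤ B / 3ᵐ < 1`
    refine (mem_polarBall_zero R e').2 ⟨hKR hx, ?_⟩
    rw [hnorm, div_lt_one h3]
    exact (hB' ⟨x, hKR hx⟩ hx).trans_lt hmB
  · -- `t ∈ CS ⇒ 1 - (1 - t)/3ᵐ ∈ CS ∩ [t₀, 1]`
    rw [polarBall_trans_smul R e m t]
    refine hP _ (one_sub_div_pow_mem_cantorSet ht m) ?_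
    have ht1 : (1 - t) / 3 ^ m ≤ 1 / 3 ^ m :=
      div_le_div_of_nonneg_right (by linarith [(cantorSet_subset_unitInterval ht).1]) h3.le
    have h1t₀ : 0 < 1 - t₀ := sub_pos.2 ht₀
    have h2 : 1 / 3 ^ m < 1 - t₀ := by
      rw [div_lt_iff₀ h3]
      rw [div_lt_iff₀ h1t₀] at hmt
      linarith [mul_comm (1 - t₀) ((3 : ℝ) ^ m)]
    linarith

end Normalisation

end Literature.Barriers.SmoothPoincare4
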